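import Summits.KontsevichZagierPeriods.KontsevichZagierPeriods.Theorems.HurwitzMicroSectorsNormalFormPrincipleLevelOne
import Summits.KontsevichZagierPeriods.KontsevichZagierPeriods.Theorems.HurwitzMicroSectorsNormalFormPrincipleSlabASubPtK20
import Summits.KontsevichZagierPeriods.KontsevichZagierPeriods.Theorems.HurwitzMicroSectorsNormalFormPrincipleAlgCarriers
import Summits.KontsevichZagierPeriods.KontsevichZagierPeriods.Theorems.HurwitzMicroSectorsNormalFormPrincipleM2FiveZetaTwo
import Summits.KontsevichZagierPeriods.KontsevichZagierPeriods.Theorems.AperySectorThreeTwo.Negative.Kit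

/-!
# `NormalFormPrinciple` (stmt-KontsevichZagierPeriods-3869), line `SketchIdeator1` — leaf `stub_boxRigidity`:
# weight three, level `K`, totally off resonance: re-banding by the coordinate permutation `(x,y,t) ↦ (x,t,y)` (rule 2)

Registered sub-goal `reband3` of the layer "Conjecture 1 for the boxes
`[(0,1)³, c x^A y^B z^D/(1 − x^K y^K z^K)]` with pairwise distinct exponents" (lead file `…Weight3`).
The merged representation `R = [B, g]` on the band `B = {(z₀,z₁) ∈ (0,1)², 0 ≤ z₂ ≤ z₀ z₁}` over
the open square, with `g = c z₀^{A'} z₁^{B'} z₂^D/(1 − z₂^K)` on `B`, and the representation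
`R' = [B', g']` on the NESTED band `B' = {0 < z₀ < 1, 0 ≤ z₁ ≤ z₀, z₁/z₀ ≤ z₂ ≤ 1}` with
`g' (z₀,z₁,z₂) = g (z₀,z₂,z₁)` on `B'`, differ by a relation of the Kontsevich–Zagier calculus:

1. (rule 2) transpose the last two coordinates (`KZ.of_sub_of_reindex_mem_relations` with the
   transposition `Equiv.swap 1 2` of `Fin 3`): the domain of `R.reindex (swap 1 2)` is
   `W = {(w₀,w₂) ∈ (0,1)², 0 ≤ w₁ ≤ w₀ w₂}` and its integrand is `g ∘ swap`, which agrees with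
   `g'` on `W`;
2. (rule 1) null adjustment: `W ⊆ B'` EXACTLY (for `w₀ > 0` and `w₂ < 1`, `w₁ ≤ w₀ w₂` gives
   `w₁/w₀ ≤ w₂` and `w₁ ≤ w₀`), and `B' ∖ W ⊆ {w₂ = 0} ∪ {w₂ = 1}` is null (a point of `B'` with
   `0 < w₂ < 1` has `w₁ ≤ w₀ w₂`, from `w₁/w₀ ≤ w₂`), so `[B', g'] − [W, g'] ∈ relations`
   (`KZ.IntegralRep.of_sub_of_restrict_mem_relations`), while `[W, g ∘ swap] − [W, g']` is a
   congruence (`KZ.of_sub_of_mem_relations_of_eqOn`).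

References: M. Kontsevich, D. Zagier, *Periods* (2001), §1.2 rules (1), (2). No new definitions.
-/

noncomputable section

open MeasureTheory Set
open Literature.NumberTheory.Transcendental Literature.NumberTheory.Transcendental.KZ
open Literature.ModelTheory.ExponentialFields (IsSemialgebraic)

namespace Summit.KontsevichZagierPeriods.HurwitzMicroSectors.NormalFormPrinciple.PiBox.Weight3

/-! ### Membership in the two bands -/

/-- Membership in the merged band `{(z₀,z₁) ∈ (0,1)², 0 ≤ z₂ ≤ z₀ z₁} ⊆ ℝ³`, coordinatewise.
[folklore] -/
theorem w3_rb_mem_boxBand {z : Fin 3 → ℝ} :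
    z ∈ KZlog.band {y : Fin 2 → ℝ | ∀ i, y i ∈ Set.Ioo (0:ℝ) 1} (fun _ => (0:ℝ))
      (fun y => y 0 * y 1) ↔
      ((0 < z 0 ∧ z 0 < 1) ∧ (0 < z 1 ∧ z 1 < 1)) ∧ 0 ≤ z 2 ∧ z 2 ≤ z 0 * z 1 := by
  rw [KZlog.mem_band, mem_setOf_eq, Fin.forall_fin_two]
  exact Iff.rfl

/-- Membership in the nested band `{0 < z₀ < 1, 0 ≤ z₁ ≤ z₀, z₁/z₀ ≤ z₂ ≤ 1} ⊆ ℝ³`,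
coordinatewise. [folklore] -/
theorem w3_rb_mem_nestedBand {z : Fin 3 → ℝ} :
    z ∈ KZlog.band (KZlog.band {y : Fin 1 → ℝ | 0 < y 0 ∧ y 0 < 1} (fun _ => (0:ℝ)) (fun y => y 0))
      (fun w => w 1 / w 0) (fun _ => (1:ℝ)) ↔
      ((0 < z 0 ∧ z 0 < 1) ∧ 0 ≤ z 1 ∧ z 1 ≤ z 0) ∧ z 1 / z 0 ≤ z 2 ∧ z 2 ≤ 1 :=
  Iff.rfl

/-! ### The stub -/

/-- **W3 (re-banding, rule 2: the coordinate permutation `(x,y,t) ↦ (x,t,y)`; registered sub-goal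
of the weight-three totally-off-resonance layer of `stub_boxRigidity`).** The band
`{(x,y) ∈ (0,1)², 0 ≤ t ≤ xy}` with integrand `g(x,y,t) = c x^{A'} y^{B'} t^D/(1 − t^K)` is, up to
null sets, the nested band `{(x,t) : 0<x<1, 0≤t≤x} × {t/x ≤ y ≤ 1}` with integrand `g(x,y,t)` read
in the coordinates `(x,t,y)`: transpose the last two coordinates (rule 2,
`KZ.of_sub_of_reindex_mem_relations`) — the transposed band `W` lies inside the nested band — and
remove the null set `{y = 0} ∪ {y = 1}` containing the difference (rule 1,
`KZ.IntegralRep.of_sub_of_restrict_mem_relations`, `KZ.of_sub_of_mem_relations_of_eqOn`).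
[cite: KontsevichZagier2001, §1.2 rules (1), (2)] -/
theorem reband3 (K : ℕ) (hK : 0 < K) (A' B' D : ℕ) (c : ℝ) (hc : IsAlgebraic ℚ c)
    (R R' : IntegralRep 3)
    (hRd : R.domain = KZlog.band {y : Fin 2 → ℝ | ∀ i, y i ∈ Set.Ioo (0:ℝ) 1} (fun _ => (0:ℝ))
      (fun y => y 0 * y 1))
    (hRi : EqOn R.integrand (fun z => c * (z 0 ^ A' * z 1 ^ B' * z 2 ^ D) / (1 - z 2 ^ K)) R.domain)
    (hR'd : R'.domain = KZlog.band
      (KZlog.band {y : Fin 1 → ℝ | 0 < y 0 ∧ y 0 < 1} (fun _ => (0:ℝ)) (fun y => y 0))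
      (fun w => w 1 / w 0) (fun _ => (1:ℝ)))
    (hR'i : EqOn R'.integrand (fun z => c * (z 0 ^ A' * z 2 ^ B' * z 1 ^ D) / (1 - z 1 ^ K))
      R'.domain) :
    of R - of R' ∈ relations := by
  have _ := hK
  have _ := hc
  have h01 : (0 : Fin 3) ≠ 1 := by decide
  have h02 : (0 : Fin 3) ≠ 2 := by decide
  -- membership in the merged band `B`, the transposed band `W` and the nested band `B'`
  have hmemR : ∀ z : Fin 3 → ℝ, z ∈ R.domain ↔
      ((0 < z 0 ∧ z 0 < 1) ∧ (0 < z 1 ∧ z 1 < 1)) ∧ 0 ≤ z 2 ∧ z 2 ≤ z 0 * z 1 := fun z => by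
    rw [hRd]
    exact w3_rb_mem_boxBand
  have hmemW : ∀ w : Fin 3 → ℝ, w ∈ (R.reindex (Equiv.swap (1 : Fin 3) 2)).domain ↔
      ((0 < w 0 ∧ w 0 < 1) ∧ (0 < w 2 ∧ w 2 < 1)) ∧ 0 ≤ w 1 ∧ w 1 ≤ w 0 * w 2 := fun w => by
    rw [IntegralRep.reindex_domain, mem_setOf_eq, hmemR]
    simp only [Equiv.swap_apply_left, Equiv.swap_apply_right, Equiv.swap_apply_of_ne_of_ne h01 h02]
  have hmemR' : ∀ w : Fin 3 → ℝ, w ∈ R'.domain ↔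
      ((0 < w 0 ∧ w 0 < 1) ∧ 0 ≤ w 1 ∧ w 1 ≤ w 0) ∧ w 1 / w 0 ≤ w 2 ∧ w 2 ≤ 1 := fun w => by
    rw [hR'd]
    exact w3_rb_mem_nestedBand
  -- the transposed band `W` is `ℚ`-semialgebraic and lies inside the nested band `B'`
  have hW : IsSemialgebraic ℚ (R.reindex (Equiv.swap (1 : Fin 3) 2)).domain :=
    (R.reindex (Equiv.swap (1 : Fin 3) 2)).isSemialgebraic_domain
  have hWR' : (R.reindex (Equiv.swap (1 : Fin 3) 2)).domain ⊆ R'.domain := fun w hw => by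
    obtain ⟨⟨⟨h0, h0'⟩, _, h2'⟩, h1, h1'⟩ := (hmemW w).1 hw
    exact (hmemR' w).2 ⟨⟨⟨h0, h0'⟩, h1, h1'.trans (mul_le_of_le_one_right h0.le h2'.le)⟩,
      (div_le_iff₀ h0).2 (h1'.trans_eq (mul_comm _ _)), h2'.le⟩
  -- `B' ∖ W ⊆ {w₂ = 0} ∪ {w₂ = 1}` is null
  have hvol : volume (R'.domain \ (R.reindex (Equiv.swap (1 : Fin 3) 2)).domain) = 0 := by
    refine measure_mono_null (fun w hw => ?_)
      (measure_union_null (Measure.pi_hyperplane (fun _ => (volume : Measure ℝ)) 2 0)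
        (Measure.pi_hyperplane (fun _ => (volume : Measure ℝ)) 2 1))
    rcases eq_or_ne (w 2) 0 with h20 | h20
    · exact Or.inl h20
    rcases eq_or_ne (w 2) 1 with h21 | h21
    · exact Or.inr h21
    obtain ⟨⟨⟨h0, h0'⟩, h1, _⟩, h12, h2⟩ := (hmemR' w).1 hw.1
    refine absurd ((hmemW w).2 ⟨⟨⟨h0, h0'⟩, ?_, lt_of_le_of_ne h2 h21⟩, h1, ?_⟩) hw.2
    · exact lt_of_le_of_ne ((div_nonneg h1 h0.le).trans h12) (Ne.symm h20)
    · exact ((div_le_iff₀ h0).1 h12).trans_eq (mul_comm _ _)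
  -- (1) rule 2: the transposition of the last two coordinates
  have hS := of_sub_of_reindex_mem_relations R (Equiv.swap (1 : Fin 3) 2)
  -- (2) rule 1: the null adjustment of `R'` to `W` and the congruence on `W`
  have hres := IntegralRep.of_sub_of_restrict_mem_relations R' hW hWR' hvol
  have hcmp : of (R.reindex (Equiv.swap (1 : Fin 3) 2)) - of (R'.restrict _ hW hWR') ∈
      relations := by
    refine of_sub_of_mem_relations_of_eqOn rfl fun w hw => ?_
    have hw' : (fun i => w (Equiv.swap (1 : Fin 3) 2 i)) ∈ R.domain := hw
    show R.integrand (fun i => w (Equiv.swap (1 : Fin 3) 2 i)) = R'.integrand w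
    rw [hRi hw', hR'i (hWR' hw)]
    simp only [Equiv.swap_apply_left, Equiv.swap_apply_right, Equiv.swap_apply_of_ne_of_ne h01 h02]
  -- (3) bookkeeping
  have key : of R - of R' = (of R - of (R.reindex (Equiv.swap (1 : Fin 3) 2))) +
      (of (R.reindex (Equiv.swap (1 : Fin 3) 2)) - of (R'.restrict _ hW hWR')) -
      (of R' - of (R'.restrict _ hW hWR')) := by
    abel
  rw [key]
  exact relations.sub_mem (relations.add_mem hS hcmp) hres

end Summit.KontsevichZagierPeriods.HurwitzMicroSectors.NormalFormPrinciple.PiBox.Weight3
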